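import Summits.ValiantsHypothesis.ValiantsHypothesis.Theorems.TwistedDetRankFermionicNormalFormSummitHard
import Literature.Computability.AlgebraicComplexity.LMR13BoundaryFormDcThree
import Literature.Computability.AlgebraicComplexity.DeterminantalComplexityProofs
import Literature.Computability.AlgebraicComplexity.PermanentVsDeterminant

/-!
# Crux `TwistedDetRank.SliceVBPFermionic` (stmt-ValiantsHypothesis-17991, X2b) — the bipartite
# RETURN GADGET: every class-function GMF on `S_{2a}` projects onto a multiple of `per_a`

X2b says: a CLASS-FUNCTION generalised matrix function `f_n = Σ_σ χ_n(σ) Π_i X_{σ(i),i}` with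
affine determinantal representations of p-bounded size ("the VBP slice") is, for `n ≥ 1`, a sum
of quasi-polynomially many twisted determinants.  X2b implies `VNP ⊄ VBP`
(`DcPerSuperpolynomial ℂ`; Theorems/TwistedDetRankSliceVBPFermionicCalibration.lean), so it can
only be SETTLED cheaply by a refutation: a class-function family PROVABLY in the VBP slice with
super-quasi-polynomial tdr.  The item's `why it might fail` names the candidate: the `2`-cycle
twist `χ_μ = sgn · μ^{c₂}` ("tdr ≥ 2^{n/4} by the block-swap flattening; it refutes X2b iff its GMF
`Σ_M (1−μ)^{|M|} X^M det(X_{M̄})` has polynomial dc (expected VNP-hard; open)").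

This file decides that question in the tree's vocabulary, by an elementary PROJECTION GADGET
(all kernel-checked, no named facts):

* §1–§2 RETURN GADGET.  Index `2a` points as `A ⊔ A` (`A = Fin a`, transported along
  `finSumFinEquiv`) and substitute the block matrix `(0 Y; Z 0)` — variables `Y` from the first
  copy to the second, a constant "return block" `Z` back.  Only the block swaps
  `σ_{p,q}` (`inl i ↦ inr (p i)`, `inr i ↦ inl (q i)`; `swapPerm` of the flattening file) survive,
  and `σ_{p,q}` contributes `(Π_i Z_{p(i),i}) · Y^q` (`aeval_retSubstFin_gmf`).
* §3 For a CLASS FUNCTION `χ` and `Z = J` (all ones) the inner sum is independent of `q`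
  (`σ_{p,q} ∼ σ_{1,qp}`), so `f_{2a}(0 Y; J 0) = c_a(χ) · per_a(Y)` with the DOUBLING SUM
  `c_a(χ) = Σ_{ρ ∈ S_a} χ(σ_{1,ρ})` (`aeval_retSubstFin_ones_gmf`,
  `isProjection_doublingSum_mul_perPoly`): EVERY class-function GMF on `S_{2a}` projects onto a
  scalar multiple of the `a × a` permanent.  With `Z = 1` one gets instead the GMF of the DOUBLED
  coefficient function `ρ ↦ χ(σ_{1,ρ})` (`aeval_retSubstFin_one_gmf`; e.g. the strategist's
  `G_{2a} = Σ_{σ: all cycles even} sgn σ 2^{c(σ)} X^σ` doubles to the `2`-fermionant, `⊕P`-hard).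
* §4 `dc` TRANSFER: `dc(per_a) ≤ dc(f_{2a}) + 1` whenever `c_a(χ) ≠ 0`
  (`hasDetRepr_perPoly_of_hasDetRepr_gmf`); hence a class-function family in the VBP slice
  whose doubling sums are eventually non-zero forces `¬ DcPerSuperpolynomial ℂ`
  (`not_dcPerSuperpolynomial_of_hasDetRepr_of_doublingSum_ne_zero`).  A witness against X2b that
  is not simultaneously a proof of `VBP = VNP` must therefore have `c_a(χ_{2a}) = 0` for
  infinitely many `a`.
* THE NAMED FALSIFIER `sgn · μ^{c₂}` is treated in the sequel file
  Theorems/TwistedDetRankSliceVBPFermionicTwoCycleTwist.lean: its doubling sums are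
  `± det((μ−1)·1 + J_a) ≠ 0` for `a > ‖μ−1‖`, so it lies in the VBP slice only if `VBP = VNP`.

HONEST FRAMING.  This neither proves nor refutes X2b (X2b ≥ `VNP ⊄ VBP`); it removes the one
falsifier on record and constrains all others (vanishing doubling sums), i.e. it is census work
on the refutation side.  `VP ≠ VNP` is not moved by this item.

References: L. G. Valiant, STOC 1979 (projections); P. Bürgisser, *Completeness and Reduction in
Algebraic Complexity Theory* (2000) §2.1, §2.5, Ch. 7; S. Mertens, C. Moore, Theory of Computing 9
(2013) 273–282 (arXiv:1110.1821), Thms 1–2 (fermionants); R. Curticapean, STOC 2021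
(arXiv:2102.04340) (immanant dichotomy); N. de Rugy-Altherre, CiE 2013, LNCS 7921, 87–96 (the averaging
layer `inr j → inl b`, cf. Theorems/FermionicJetHcProjectsToCdet.lean).  The `def`s below
(`retSubst`, `retSubstFin`, `doublingSum`) are proof gadgets naming the substitution, not route
objects.
-/

-- single-conjunct layout: Sub = Summit, duplicated namespace component intended
set_option linter.dupNamespace false

noncomputable section

namespace Summit.ValiantsHypothesis.ValiantsHypothesis.Theorems.TwistedDetRankSliceVBPFermionic

open Equiv MvPolynomial Literature.Computability.AlgebraicComplexity
open Summit.ValiantsHypothesis.ValiantsHypothesis.Theorems.TwistedDetRankFermionicNormalForm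
open scoped BigOperators

/-! ## §1 The return substitution on the doubled index set `A ⊔ A`, `A = Fin a` -/

section Gadget

variable {a : ℕ}

/-- The RETURN SUBSTITUTION with return block `Z`: on the doubled index set `A ⊔ A` the variable
`x_{(r,c)}` becomes `y_{(r,c)}` for `r` in the first and `c` in the second copy, the constant
`Z r c` for `r` in the second and `c` in the first copy, and `0` on the two diagonal blocks
(the block matrix `(0 Y; Z 0)`).  A proof gadget, not a route object. [folklore] -/
def retSubst (Z : Matrix (Fin a) (Fin a) ℂ) :
    (Fin a ⊕ Fin a) × (Fin a ⊕ Fin a) → MvPolynomial (Fin a × Fin a) ℂ := fun rc =>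
  Sum.elim (fun r => Sum.elim (fun _ => 0) (fun c => X (r, c)) rc.2)
    (fun r => Sum.elim (fun c => C (Z r c)) (fun _ => 0) rc.2) rc.1

/-- Diagonal block (first copy): `0`. -/
@[simp] theorem retSubst_inl_inl (Z : Matrix (Fin a) (Fin a) ℂ) (r c : Fin a) :
    retSubst Z (Sum.inl r, Sum.inl c) = 0 := rfl
/-- Off-diagonal block (rows first copy, columns second copy): the variables `Y`. -/
@[simp] theorem retSubst_inl_inr (Z : Matrix (Fin a) (Fin a) ℂ) (r c : Fin a) :
    retSubst Z (Sum.inl r, Sum.inr c) = X (r, c) := rfl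
/-- Off-diagonal block (rows second copy, columns first copy): the return block `Z`. -/
@[simp] theorem retSubst_inr_inl (Z : Matrix (Fin a) (Fin a) ℂ) (r c : Fin a) :
    retSubst Z (Sum.inr r, Sum.inl c) = C (Z r c) := rfl
/-- Diagonal block (second copy): `0`. -/
@[simp] theorem retSubst_inr_inr (Z : Matrix (Fin a) (Fin a) ℂ) (r c : Fin a) :
    retSubst Z (Sum.inr r, Sum.inr c) = 0 := rfl

/-- Every value of the return substitution is affine (a variable, a constant or `0`). [folklore] -/
theorem totalDegree_retSubst_le (Z : Matrix (Fin a) (Fin a) ℂ)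
    (rc : (Fin a ⊕ Fin a) × (Fin a ⊕ Fin a)) : (retSubst Z rc).totalDegree ≤ 1 := by
  obtain ⟨r | r, c | c⟩ := rc
  · simp
  · rw [retSubst_inl_inr, totalDegree_X]
  · simp
  · simp

/-- Every value of the return substitution is a variable or a constant (a Valiant projection).
[folklore] -/
theorem retSubst_isVarOrConst (Z : Matrix (Fin a) (Fin a) ℂ)
    (rc : (Fin a ⊕ Fin a) × (Fin a ⊕ Fin a)) :
    (∃ j, retSubst Z rc = X j) ∨ ∃ c, retSubst Z rc = C c := by
  obtain ⟨r | r, c | c⟩ := rc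
  · exact Or.inr ⟨0, by simp⟩
  · exact Or.inl ⟨(r, c), rfl⟩
  · exact Or.inr ⟨Z r c, rfl⟩
  · exact Or.inr ⟨0, by simp⟩

/-- On a block-swap permutation `σ_{p,q}` the substituted monomial is `(Π_i Z (p i) i) · y^q`.
[folklore] -/
theorem prod_retSubst_swapPerm (Z : Matrix (Fin a) (Fin a) ℂ) (p q : Perm (Fin a)) :
    ∏ z, retSubst Z (swapPerm p q z, z) =
      C (∏ i, Z (p i) i) * ∏ i, (X (q i, i) : MvPolynomial (Fin a × Fin a) ℂ) := by
  rw [Fintype.prod_sum_type, map_prod]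
  simp

/-- A permutation of `A ⊔ A` that is not a block swap `σ_{p,q}` kills the substituted monomial:
some point of the first copy is not sent to the second copy, and the corresponding factor is
`0`; otherwise `sumComm ∘ τ` preserves the copies and `τ` is a block swap
(`Equiv.Perm.mem_sumCongrHom_range_of_perm_mapsTo_inl`). [folklore] -/
theorem prod_retSubst_eq_zero (Z : Matrix (Fin a) (Fin a) ℂ) (τ : Perm (Fin a ⊕ Fin a))
    (hτ : ∀ p q : Perm (Fin a), τ ≠ swapPerm p q) :
    ∏ z, retSubst Z (τ z, z) = 0 := by
  classical
  by_contra hne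
  have hfac : ∀ z, retSubst Z (τ z, z) ≠ 0 := fun z hz =>
    hne (Finset.prod_eq_zero (Finset.mem_univ z) hz)
  have hmaps : Set.MapsTo ((Equiv.sumComm (Fin a) (Fin a) : Perm (Fin a ⊕ Fin a)) * τ)
      (Set.range Sum.inl) (Set.range Sum.inl) := by
    rintro _ ⟨i, rfl⟩
    rw [Perm.mul_apply]
    cases h : τ (Sum.inl i) with
    | inl r => exact absurd (by rw [h]; rfl) (hfac (Sum.inl i))
    | inr r => exact ⟨r, rfl⟩
  obtain ⟨pq, hpq⟩ := Perm.mem_sumCongrHom_range_of_perm_mapsTo_inl hmaps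
  apply hτ pq.1 pq.2
  rw [Perm.sumCongrHom_apply] at hpq
  have hsq : (Equiv.sumComm (Fin a) (Fin a) : Perm (Fin a ⊕ Fin a)) *
      (Equiv.sumComm (Fin a) (Fin a) : Perm (Fin a ⊕ Fin a)) = 1 := by
    ext z; cases z <;> rfl
  calc τ = ((Equiv.sumComm (Fin a) (Fin a) : Perm (Fin a ⊕ Fin a)) *
        (Equiv.sumComm (Fin a) (Fin a) : Perm (Fin a ⊕ Fin a))) * τ := by rw [hsq, one_mul]
    _ = (Equiv.sumComm (Fin a) (Fin a) : Perm (Fin a ⊕ Fin a)) * pq.1.sumCongr pq.2 := by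
        rw [mul_assoc, hpq]
    _ = swapPerm pq.1 pq.2 := rfl

/-- `(p, q) ↦ σ_{p,q}` is injective. [folklore] -/
theorem swapPerm_injective :
    Function.Injective (fun pq : Perm (Fin a) × Perm (Fin a) => swapPerm pq.1 pq.2) := by
  rintro ⟨p, q⟩ ⟨p', q'⟩ h
  simp only at h
  have hp : p = p' := Equiv.ext fun i => by
    have := congrArg (fun σ => σ (Sum.inl i)) h
    simpa using this
  have hq : q = q' := Equiv.ext fun i => by
    have := congrArg (fun σ => σ (Sum.inr i)) h
    simpa using this
  rw [hp, hq]

/-- **The return gadget on `A ⊔ A`.** Substituting `(0 Y; Z 0)` into the GMF of an arbitrary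
coefficient function `χ'` on `Perm (A ⊔ A)` leaves the GMF on `A` of
`q ↦ Σ_p (Π_i Z (p i) i) · χ'(σ_{p,q})`: only block swaps survive, and `σ_{p,q}` contributes
`(Π_i Z (p i) i) · y^q`. [folklore] -/
theorem aeval_retSubst_gmf (Z : Matrix (Fin a) (Fin a) ℂ) (χ' : Perm (Fin a ⊕ Fin a) → ℂ) :
    aeval (retSubst Z) (∑ τ : Perm (Fin a ⊕ Fin a), C (χ' τ) *
        ∏ z, (X (τ z, z) : MvPolynomial ((Fin a ⊕ Fin a) × (Fin a ⊕ Fin a)) ℂ)) =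
      ∑ q : Perm (Fin a), C (∑ p : Perm (Fin a), (∏ i, Z (p i) i) * χ' (swapPerm p q)) *
        ∏ i, (X (q i, i) : MvPolynomial (Fin a × Fin a) ℂ) := by
  classical
  have hL : aeval (retSubst Z) (∑ τ : Perm (Fin a ⊕ Fin a), C (χ' τ) *
        ∏ z, (X (τ z, z) : MvPolynomial ((Fin a ⊕ Fin a) × (Fin a ⊕ Fin a)) ℂ)) =
      ∑ τ : Perm (Fin a ⊕ Fin a), C (χ' τ) * ∏ z, retSubst Z (τ z, z) := by
    simp only [map_sum, map_mul, aeval_C, map_prod, aeval_X, algebraMap_eq]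
  rw [hL]
  let emb : Perm (Fin a) × Perm (Fin a) ↪ Perm (Fin a ⊕ Fin a) := ⟨_, swapPerm_injective⟩
  have hsub : (Finset.univ.map emb) ⊆ (Finset.univ : Finset (Perm (Fin a ⊕ Fin a))) :=
    Finset.subset_univ _
  rw [← Finset.sum_subset hsub, Finset.sum_map, Fintype.sum_prod_type, Finset.sum_comm]
  · refine Finset.sum_congr rfl fun q _ => ?_
    rw [map_sum, Finset.sum_mul]
    refine Finset.sum_congr rfl fun p _ => ?_
    change C (χ' (swapPerm p q)) * ∏ z, retSubst Z (swapPerm p q z, z) = _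
    rw [prod_retSubst_swapPerm, ← mul_assoc, ← map_mul, mul_comm (χ' _)]
  · intro τ _ hτ
    have hτ' : ∀ p q : Perm (Fin a), τ ≠ swapPerm p q := by
      intro p q h
      exact hτ (Finset.mem_map.2 ⟨(p, q), Finset.mem_univ _, h.symm⟩)
    rw [prod_retSubst_eq_zero Z τ hτ', mul_zero]

/-! ## §2 Transport to `Fin (a + a)` -/

/-- A GMF on `Fin (a + a)` is the relabelling along `finSumFinEquiv` of the GMF on `Fin a ⊔ Fin a`
of the transported coefficient function. [folklore] -/
theorem gmf_eq_rename (χ : Perm (Fin (a + a)) → ℂ) :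
    (∑ σ : Perm (Fin (a + a)), C (χ σ) *
        ∏ i, (X (σ i, i) : MvPolynomial (Fin (a + a) × Fin (a + a)) ℂ)) =
      rename (Prod.map finSumFinEquiv finSumFinEquiv)
        (∑ τ : Perm (Fin a ⊕ Fin a), C (χ (finSumFinEquiv.permCongr τ)) *
          ∏ z, (X (τ z, z) : MvPolynomial ((Fin a ⊕ Fin a) × (Fin a ⊕ Fin a)) ℂ)) := by
  set e := (finSumFinEquiv : Fin a ⊕ Fin a ≃ Fin (a + a)) with he
  simp only [map_sum, map_mul, rename_C, map_prod, rename_X, Prod.map_apply]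
  symm
  refine Fintype.sum_equiv e.permCongr _ _ fun τ => ?_
  congr 1
  refine Fintype.prod_equiv e _ _ fun z => ?_
  simp [Equiv.permCongr_apply]

/-- The return substitution on `Fin (a + a)` (transport of `retSubst` along `finSumFinEquiv`).
A proof gadget, not a route object. [folklore] -/
def retSubstFin (Z : Matrix (Fin a) (Fin a) ℂ) :
    Fin (a + a) × Fin (a + a) → MvPolynomial (Fin a × Fin a) ℂ :=
  fun rc => retSubst Z (finSumFinEquiv.symm rc.1, finSumFinEquiv.symm rc.2)

/-- Every value of the transported return substitution is affine. [folklore] -/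
theorem totalDegree_retSubstFin_le (Z : Matrix (Fin a) (Fin a) ℂ) (rc : Fin (a + a) × Fin (a + a)) :
    (retSubstFin Z rc).totalDegree ≤ 1 := totalDegree_retSubst_le Z _
/-- Every value of the transported return substitution is a variable or a constant. [folklore] -/
theorem retSubstFin_isVarOrConst (Z : Matrix (Fin a) (Fin a) ℂ) (rc : Fin (a + a) × Fin (a + a)) :
    (∃ j, retSubstFin Z rc = X j) ∨ ∃ c, retSubstFin Z rc = C c := retSubst_isVarOrConst Z _

/-- **The return gadget on `Fin (a + a)`.** Substituting `(0 Y; Z 0)` (blocks along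
`finSumFinEquiv`) into the GMF of `χ` leaves the GMF on `Fin a` of
`q ↦ Σ_p (Π_i Z (p i) i) · χ(σ_{p,q})`. [folklore] -/
theorem aeval_retSubstFin_gmf (Z : Matrix (Fin a) (Fin a) ℂ) (χ : Perm (Fin (a + a)) → ℂ) :
    aeval (retSubstFin Z) (∑ σ : Perm (Fin (a + a)), C (χ σ) *
        ∏ i, (X (σ i, i) : MvPolynomial (Fin (a + a) × Fin (a + a)) ℂ)) =
      ∑ q : Perm (Fin a), C (∑ p : Perm (Fin a),
          (∏ i, Z (p i) i) * χ (finSumFinEquiv.permCongr (swapPerm p q))) *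
        ∏ i, (X (q i, i) : MvPolynomial (Fin a × Fin a) ℂ) := by
  rw [gmf_eq_rename, aeval_rename]
  have hcomp : (retSubstFin Z) ∘ (Prod.map finSumFinEquiv finSumFinEquiv) = retSubst Z := by
    funext rc
    obtain ⟨r, c⟩ := rc
    simp [retSubstFin]
  rw [hcomp]
  exact aeval_retSubst_gmf Z _

/-! ## §3 Class functions: return block `J` gives `c_a(χ) · per_a`, return block `1` the doubling -/

/-- `σ_{p,q}` is conjugate to `σ_{1,qp}` (by `1 ⊔ p`). [folklore] -/
theorem swapPerm_eq_conj (p q : Perm (Fin a)) :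
    swapPerm p q = (Equiv.sumCongr (1 : Perm (Fin a)) p : Perm (Fin a ⊕ Fin a)) *
      swapPerm 1 (q * p) * (Equiv.sumCongr (1 : Perm (Fin a)) p : Perm (Fin a ⊕ Fin a))⁻¹ := by
  rw [eq_mul_inv_iff_mul_eq]
  ext z
  cases z with
  | inl i => rfl
  | inr i => rfl

/-- The DOUBLING SUM `c_a(χ) := Σ_{ρ ∈ S_a} χ(σ_{1,ρ})` of a coefficient function `χ` on
`S_{a+a}`: the sum of `χ` over one representative of each "doubled" permutation (`σ_{1,ρ}` has
the cycles of `ρ` with all lengths doubled, fixed points becoming `2`-cycles).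
A proof gadget, not a route object. [folklore] -/
def doublingSum (χ : Perm (Fin (a + a)) → ℂ) : ℂ :=
  ∑ ρ : Perm (Fin a), χ (finSumFinEquiv.permCongr (swapPerm 1 ρ))

/-- For a CLASS FUNCTION `χ` the inner sum of the `J`-gadget does not depend on `q`: it is the
doubling sum (conjugate `σ_{p,q} ∼ σ_{1,qp}` and reindex `p ↦ q p`). [folklore] -/
theorem sum_swapPerm_eq_doublingSum (χ : Perm (Fin (a + a)) → ℂ)
    (hχ : ∀ σ τ : Perm (Fin (a + a)), χ (τ * σ * τ⁻¹) = χ σ) (q : Perm (Fin a)) :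
    ∑ p : Perm (Fin a), χ (finSumFinEquiv.permCongr (swapPerm p q)) = doublingSum χ := by
  have hconj : ∀ p : Perm (Fin a), χ (finSumFinEquiv.permCongr (swapPerm p q)) =
      χ (finSumFinEquiv.permCongr (swapPerm 1 (q * p))) := by
    intro p
    rw [swapPerm_eq_conj p q]
    have hE : ∀ σ : Perm (Fin a ⊕ Fin a), finSumFinEquiv.permCongr σ =
        (finSumFinEquiv : Fin a ⊕ Fin a ≃ Fin (a + a)).permCongrHom σ := fun σ => rfl
    simp only [hE, map_mul, map_inv, hχ]
  simp_rw [hconj]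
  exact Equiv.sum_comp (Equiv.mulLeft q) (fun ρ => χ (finSumFinEquiv.permCongr (swapPerm 1 ρ)))

/-- `per_a` as the GMF of `χ ≡ 1` without the constant factor. [folklore] -/
theorem perPoly_eq_sum_prod (a : ℕ) :
    perPoly (Fin a) ℂ = ∑ q : Perm (Fin a), ∏ i, (X (q i, i) : MvPolynomial (Fin a × Fin a) ℂ) := by
  simp [perPoly, Matrix.permanent]

/-- **The `J`-gadget.** For a class function `χ` on `S_{a+a}`, substituting `(0 Y; J 0)` (`J` the
all-ones block) into its GMF gives `c_a(χ) · per_a(Y)` with `c_a(χ)` the doubling sum: every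
class-function GMF on `S_{2a}` PROJECTS onto a scalar multiple of the `a × a` permanent.
[folklore] -/
theorem aeval_retSubstFin_ones_gmf (χ : Perm (Fin (a + a)) → ℂ)
    (hχ : ∀ σ τ : Perm (Fin (a + a)), χ (τ * σ * τ⁻¹) = χ σ) :
    aeval (retSubstFin (Matrix.of fun _ _ => (1 : ℂ))) (∑ σ : Perm (Fin (a + a)), C (χ σ) *
        ∏ i, (X (σ i, i) : MvPolynomial (Fin (a + a) × Fin (a + a)) ℂ)) =
      C (doublingSum χ) * perPoly (Fin a) ℂ := by
  have h1 : ∀ p : Perm (Fin a),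
      (∏ i, (Matrix.of fun _ _ => (1 : ℂ) : Matrix (Fin a) (Fin a) ℂ) (p i) i) = 1 :=
    fun p => Finset.prod_eq_one fun i _ => rfl
  rw [aeval_retSubstFin_gmf, perPoly_eq_sum_prod, Finset.mul_sum]
  refine Finset.sum_congr rfl fun q _ => ?_
  rw [← sum_swapPerm_eq_doublingSum χ hχ q]
  congr 2
  exact Finset.sum_congr rfl fun p _ => by rw [h1 p, one_mul]

/-- In the tree's vocabulary: `c_a(χ) · per_a` is a Valiant PROJECTION of the GMF of the class
function `χ` on `S_{a+a}` (`IsProjection`: substitute variables and constants). [folklore] -/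
theorem isProjection_doublingSum_mul_perPoly (χ : Perm (Fin (a + a)) → ℂ)
    (hχ : ∀ σ τ : Perm (Fin (a + a)), χ (τ * σ * τ⁻¹) = χ σ) :
    IsProjection (C (doublingSum χ) * perPoly (Fin a) ℂ)
      (∑ σ : Perm (Fin (a + a)), C (χ σ) *
        ∏ i, (X (σ i, i) : MvPolynomial (Fin (a + a) × Fin (a + a)) ℂ)) :=
  ⟨retSubstFin (Matrix.of fun _ _ => (1 : ℂ)), retSubstFin_isVarOrConst _,
    (aeval_retSubstFin_ones_gmf χ hχ).symm⟩

/-- Only `p = 1` has all its graph entries on the diagonal of the identity matrix. [folklore] -/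
theorem prod_one_apply_perm (p : Perm (Fin a)) :
    ∏ i, (1 : Matrix (Fin a) (Fin a) ℂ) (p i) i = if p = 1 then 1 else 0 := by
  split_ifs with hp
  · subst hp
    exact Finset.prod_eq_one fun i _ => Matrix.one_apply_eq i
  · obtain ⟨i, hi⟩ : ∃ i, p i ≠ i := by
      by_contra h
      push Not at h
      exact hp (Equiv.ext h)
    exact Finset.prod_eq_zero (Finset.mem_univ i) (Matrix.one_apply_ne hi)

/-- **The `1`-gadget (doubling).** Substituting `(0 Y; 1 0)` into the GMF of ANY coefficient
function `χ` on `S_{a+a}` gives the GMF on `S_a` of the doubled function `ρ ↦ χ(σ_{1,ρ})`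
(e.g. `G_{2a} = Σ_{σ: all cycles even} sgn σ · 2^{c(σ)} X^σ ↦ ± Σ_ρ sgn ρ · 2^{c(ρ)} Y^ρ`, the
`2`-fermionant of Mertens–Moore). [folklore] -/
theorem aeval_retSubstFin_one_gmf (χ : Perm (Fin (a + a)) → ℂ) :
    aeval (retSubstFin (1 : Matrix (Fin a) (Fin a) ℂ)) (∑ σ : Perm (Fin (a + a)), C (χ σ) *
        ∏ i, (X (σ i, i) : MvPolynomial (Fin (a + a) × Fin (a + a)) ℂ)) =
      ∑ ρ : Perm (Fin a), C (χ (finSumFinEquiv.permCongr (swapPerm 1 ρ))) *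
        ∏ i, (X (ρ i, i) : MvPolynomial (Fin a × Fin a) ℂ) := by
  rw [aeval_retSubstFin_gmf]
  refine Finset.sum_congr rfl fun q _ => ?_
  congr 2
  simp_rw [prod_one_apply_perm, ite_mul, one_mul, zero_mul]
  rw [Finset.sum_ite_eq' Finset.univ (1 : Perm (Fin a))]
  simp

/-! ## §4 Determinantal complexity: a VBP class-function family with non-vanishing doubling sums
puts the permanent in VBP -/

/-- **`dc` transfer through the `J`-gadget.** If the GMF of a class function `χ` on `S_{a+a}` has
an affine determinantal representation of size `m` and `c_a(χ) ≠ 0`, then `per_a` has one of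
size `m + 1` (substitute the gadget, `hasDetRepr_aeval_linear`; rescale a row by `c_a(χ)⁻¹`,
`hasDetRepr_C_mul`). [folklore] -/
theorem hasDetRepr_perPoly_of_hasDetRepr_gmf (χ : Perm (Fin (a + a)) → ℂ)
    (hχ : ∀ σ τ : Perm (Fin (a + a)), χ (τ * σ * τ⁻¹) = χ σ) {m : ℕ}
    (h : HasDetRepr (∑ σ : Perm (Fin (a + a)), C (χ σ) *
        ∏ i, (X (σ i, i) : MvPolynomial (Fin (a + a) × Fin (a + a)) ℂ)) m)
    (hd : doublingSum χ ≠ 0) :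
    HasDetRepr (perPoly (Fin a) ℂ) (m + 1) := by
  have h1 : HasDetRepr (C (doublingSum χ) * perPoly (Fin a) ℂ) m := by
    rw [← aeval_retSubstFin_ones_gmf χ hχ]
    exact hasDetRepr_aeval_linear h _ (totalDegree_retSubstFin_le _)
  have h2 := hasDetRepr_C_mul (HasDetRepr.mono_holds h1 (Nat.le_succ m)) (doublingSum χ)⁻¹
  rwa [← mul_assoc, ← map_mul, inv_mul_cancel₀ hd, map_one, one_mul] at h2

/-- **A class-function GMF family in the VBP slice whose doubling sums are eventually non-zero
puts the permanent in VBP** (`¬ DcPerSuperpolynomial ℂ`): `dc(per_a) ≤ dc(f_{2a}) + 1` for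
`a ≥ a₀` by the `J`-gadget, and the finitely many small `a` are absorbed in the constant.
Contrapositively, under `VNP ⊄ VBP` such a family never satisfies the hypothesis of X2b — it can
refute X2b only together with a proof of `VBP = VNP` (in which world X2b is false anyway, by
`χ ≡ 1`). [folklore] -/
theorem not_dcPerSuperpolynomial_of_hasDetRepr_of_doublingSum_ne_zero
    (χ : (n : ℕ) → Perm (Fin n) → ℂ)
    (hχ : ∀ (n : ℕ) (σ τ : Perm (Fin n)), χ n (τ * σ * τ⁻¹) = χ n σ)
    {a₀ : ℕ} (hd : ∀ a, a₀ ≤ a → doublingSum (χ (a + a)) ≠ 0)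
    (hdc : ∃ c : ℕ, ∀ n : ℕ, ∃ m ≤ n ^ c + c,
      HasDetRepr (∑ σ : Perm (Fin n), C (χ n σ) *
        ∏ i, (X (σ i, i) : MvPolynomial (Fin n × Fin n) ℂ)) m) :
    ¬ DcPerSuperpolynomial ℂ := by
  intro hsuper
  apply hsuper
  obtain ⟨c, hc⟩ := hdc
  set K : ℕ := ∑ b ∈ Finset.range a₀, determinantalComplexity (perPoly (Fin b) ℂ) with hK
  have hbound : ∀ a, determinantalComplexity (perPoly (Fin a) ℂ) ≤ K + ((a + a) ^ c + c + 1) := by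
    intro a
    by_cases ha : a₀ ≤ a
    · obtain ⟨m, hm, hrep⟩ := hc (a + a)
      have h1 := determinantalComplexity_le_of_hasDetRepr
        (hasDetRepr_perPoly_of_hasDetRepr_gmf (χ (a + a)) (hχ (a + a)) hrep (hd a ha))
      omega
    · have hmem : a ∈ Finset.range a₀ := Finset.mem_range.2 (by omega)
      have h1 : determinantalComplexity (perPoly (Fin a) ℂ) ≤ K :=
        Finset.single_le_sum (f := fun b => determinantalComplexity (perPoly (Fin b) ℂ))
          (fun b _ => Nat.zero_le _) hmem
      omega
  have hpow : IsPBounded (fun n : ℕ => n ^ c + c) := ⟨c, fun n => le_rfl⟩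
  have hpoly := IsPBounded.add_holds hpow (IsPBounded.const 1)
  have hdouble := IsPBounded.add_holds IsPBounded.id IsPBounded.id
  have hcomp := IsPBounded.comp_holds hpoly hdouble
  have hall := IsPBounded.add_holds (IsPBounded.const K) hcomp
  exact IsPBounded.mono hall hbound

end Gadget
end Summit.ValiantsHypothesis.ValiantsHypothesis.Theorems.TwistedDetRankSliceVBPFermionic

end
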